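import Literature.Analysis.FunctionSpaces.MollificationLp
import Literature.Analysis.FluidPDE.CKNPressureHessianSlice
import Summits.QuantumFields.YangMills.Theorems.PoincareLipschitzWeakJacobianIdentity
import Mathlib.Analysis.Calculus.BumpFunction.Convolution
import Mathlib.Analysis.InnerProductSpace.PiL2
import HarnessLib

/-!
# Crux `BlockLipschitzL` (stmt-QuantumFields-23533) ∕ `HistoryTailL` (stmt-QuantumFields-19936), LINE 25 «CompactnessTransfer»,
# stub S1″ — ROAD (W) «the (GAP) with no named fact», brick (W-EN) — file 1 «H-SYSTEM ENERGY IDENTITY: LOCALISATION LETTERS»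

Cell `ym3-torus` (YM ladder rung R3 = continuum SU(2) Yang–Mills on T³ — a RUNG, NOT Clay: not d = 4, not infinite volume,
not a mass gap); WIDTH helper seat `ym3-torus-px3` g10 (brick (W-EN) of ★w3-19936 g16's road memo `ROAD-W-WENTE-3PI-w3g16.md`);
`--supports stmt-QuantumFields-23533`; THEOREMS ONLY (0 `def`, 0 `sorry`, default heartbeats); imports lit ✓`MollificationLp`
(mollifiers, `L^p` convergence), lit ✓`CKNPressureHessianSlice` (only for `HasWeakFDerivOn.clm_comp`), px19 g8's
✓`PoincareLipschitzWeakJacobianIdentity` (the `L² × L² → L¹` letters `integrable_mul_of_L2`, `tendsto_integral_mul_of_L2`).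

WHAT THIS FILE PROVES (`E² = EuclideanSpace ℝ (Fin 2)`, `e k = EuclideanSpace.single k 1`).  Fix a scalar `u : E² → ℝ`,
CONTINUOUS and BOUNDED, with a weak gradient `Gu` on the whole plane whose components `Gu(e_k)` are square-integrable, and suppose
two square-integrable `g₀, g₁` and an integrable `J` satisfy THE ROW
`−∫ Σ_k ∂_kη · g_k = 2 ∫ η · J` for every smooth compactly supported `η`            (the shape of (F) row (iii), one component).
* §1 letters (measurability ∕ `L²` of the objects; the mollified `u`: smooth, `∂_k(ρ ⋆ u) = ρ ⋆ ∂_k u`, bounded by `3M`, `→ u`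
  pointwise, `∂_k(ρ_n ⋆ u) → ∂_k u` in `L²`).
* §2 ★★ `localised_row` — THE ROW TESTED WITH `η = χ²·(u − c)` for every smooth compactly supported `χ` and every constant `c`:
  `−∫ Σ_k (2χ ∂_kχ (u − c) + χ² ∂_k u) g_k = 2 ∫ χ² (u − c) J`
  (test the row with `χ²·(ρ_n ⋆ u − c)` and let `n → ∞`: `L² × L² → L¹` on the gradient term, dominated convergence elsewhere).
File 2 (`…HSystemEnergyIdentity`) sends `χ = χ_R → 1` and specialises to the components `u = B^a` of a finite-energy weak solution
of the `H`-system `ΔB = 2 B_x ∧ B_y`, giving `∫|∇B^a|² = −2∫(B^a − c_a)(B_x ∧ B_y)^a` and `Θ ≤ 2 Σ_a ‖B^a − c_a‖_∞ ∫|(B_x ∧ B_y)^a|`.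
HONEST SCOPE.  Sobolev calculus on the plane; nothing of (GAP), (TM), S1″, K1, `MeanDeviationL`, `BlockLipschitzL`, `HistoryTailL`
is proved here.  YM₃ on T³ is rung R3, not Clay; YM gap NOT proved; no summit statement is proved here.

References: H. C. Wente, J. Math. Anal. Appl. 26 (1969) 318–344 (the energy identity for the `H`-system) [Wente1969];
H. Brezis, J.-M. Coron, Arch. Rational Mech. Anal. 89 (1985) 21–56, Appendix, proof of Lemma A.1 [BrezisCoron1985];
L. C. Evans, Partial Differential Equations, 2nd ed. (2010), §5.3.1 Thm. 1, App. C.4 Thm. 7 (mollifiers) [Evans2010].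
-/

set_option autoImplicit false

noncomputable section

open MeasureTheory Set Filter Function Topology TopologicalSpace ContinuousLinearMap Metric
open scoped ContDiff ENNReal BigOperators Convolution

namespace Summit.QuantumFields.YangMills.Theorems.PoincareLipschitzHSystemEnergyIdentityLetters

open Literature.Analysis.FunctionSpaces
open Summit.QuantumFields.YangMills.Theorems.PoincareLipschitzWeakJacobianIdentity (integrable_mul_of_L2 tendsto_integral_mul_of_L2)

variable {u : EuclideanSpace ℝ (Fin 2) → ℝ} {Gu : EuclideanSpace ℝ (Fin 2) → (EuclideanSpace ℝ (Fin 2) →L[ℝ] ℝ)}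

/-! ## §1 Letters -/

/-- A weak gradient on `⟨univ, _⟩` is a weak gradient on `⊤`. [folklore] -/
theorem hasWeakFDerivOn_top (hu : HasWeakFDerivOn ⟨Set.univ, isOpen_univ⟩ volume u Gu) :
    HasWeakFDerivOn (⊤ : Opens (EuclideanSpace ℝ (Fin 2))) volume u Gu := hu

/-- The mollified function is smooth. [cite: Evans2010, App. C.4 Thm. 7 (i)] -/
theorem contDiff_mollify (hu : HasWeakFDerivOn ⟨Set.univ, isOpen_univ⟩ volume u Gu)
    (φ : ContDiffBump (0 : EuclideanSpace ℝ (Fin 2))) :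
    ContDiff ℝ ∞ (φ.normed volume ⋆[lsmul ℝ ℝ, volume] u) :=
  (hasWeakFDerivOn_top hu).contDiff_convolution (n := ⊤) (isTestFunctionOn_normed φ)

/-- **Mollification commutes with the weak gradient**: `∂_v(ρ ⋆ u) = ρ ⋆ ∂_v u`. [cite: Evans2010, §5.3.1 Thm. 1] -/
theorem fderiv_mollify_apply (hu : HasWeakFDerivOn ⟨Set.univ, isOpen_univ⟩ volume u Gu)
    (φ : ContDiffBump (0 : EuclideanSpace ℝ (Fin 2))) (y v : EuclideanSpace ℝ (Fin 2)) :
    fderiv ℝ (φ.normed volume ⋆[lsmul ℝ ℝ, volume] u) y v = (φ.normed volume ⋆[lsmul ℝ ℝ, volume] fun z => Gu z v) y :=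
  (hasWeakFDerivOn_top hu).fderiv_convolution_apply (isTestFunctionOn_normed φ) y v

/-- The mollification of a function bounded by `M` is bounded by `3M` (crude, enough here). [folklore] -/
theorem abs_mollify_le (huc : Continuous u) {M : ℝ} (huM : ∀ y, |u y| ≤ M)
    (φ : ContDiffBump (0 : EuclideanSpace ℝ (Fin 2))) (y : EuclideanSpace ℝ (Fin 2)) :
    |(φ.normed volume ⋆[lsmul ℝ ℝ, volume] u) y| ≤ 3 * M := by
  have h := ContDiffBump.dist_normed_convolution_le (φ := φ) (μ := volume) (x₀ := y) (ε := 2 * M)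
    huc.aestronglyMeasurable (fun x _ => by
      rw [Real.dist_eq]
      calc |u x - u y| ≤ |u x| + |u y| := abs_sub _ _
        _ ≤ M + M := add_le_add (huM x) (huM y)
        _ = 2 * M := by ring)
  rw [Real.dist_eq] at h
  calc |(φ.normed volume ⋆[lsmul ℝ ℝ, volume] u) y|
      = |((φ.normed volume ⋆[lsmul ℝ ℝ, volume] u) y - u y) + u y| := by rw [sub_add_cancel]
    _ ≤ |(φ.normed volume ⋆[lsmul ℝ ℝ, volume] u) y - u y| + |u y| := abs_add_le _ _
    _ ≤ 2 * M + M := add_le_add h (huM y)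
    _ = 3 * M := by ring

/-- Mollifications of a continuous function converge pointwise. [cite: Evans2010, App. C.4 Thm. 7 (ii)] -/
theorem tendsto_mollify (huc : Continuous u) {φ : ℕ → ContDiffBump (0 : EuclideanSpace ℝ (Fin 2))}
    (hφ : Tendsto (fun n => (φ n).rOut) atTop (𝓝 0)) (y : EuclideanSpace ℝ (Fin 2)) :
    Tendsto (fun n => ((φ n).normed volume ⋆[lsmul ℝ ℝ, volume] u) y) atTop (𝓝 (u y)) :=
  ContDiffBump.convolution_tendsto_right_of_continuous hφ huc y

/-- Mollified `L²` gradients converge in `L²`: `‖∂_v u − ∂_v(ρ_n ⋆ u)‖₂ → 0`. [cite: Evans2010, App. C.4 Thm. 7 (iv)] -/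
theorem tendsto_eLpNorm_grad_sub_mollify (hu : HasWeakFDerivOn ⟨Set.univ, isOpen_univ⟩ volume u Gu)
    {φ : ℕ → ContDiffBump (0 : EuclideanSpace ℝ (Fin 2))} (hφ : Tendsto (fun n => (φ n).rOut) atTop (𝓝 0))
    {v : EuclideanSpace ℝ (Fin 2)} (hGv : MemLp (fun y => Gu y v) 2 volume) :
    Tendsto (fun n => eLpNorm (fun y => Gu y v - fderiv ℝ ((φ n).normed volume ⋆[lsmul ℝ ℝ, volume] u) y v) 2 volume)
      atTop (𝓝 0) := by
  have h := tendsto_eLpNorm_normed_convolution_sub_self (μ := volume) hφ (p := 2) (by norm_num) (by norm_num) hGv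
  refine h.congr fun n => ?_
  rw [← eLpNorm_neg]
  congr 1
  funext y
  simp only [Pi.neg_apply, Pi.sub_apply, fderiv_mollify_apply hu, neg_sub]

/-! ## §2 The row tested with `χ² (u − c)` -/

/-- Calculus letter: `∂_v(χ²·(w − c)) = 2χ ∂_vχ (w − c) + χ² ∂_v w` for `C¹` functions `χ, w`. [folklore] -/
theorem fderiv_sq_mul_sub_apply {χ w : EuclideanSpace ℝ (Fin 2) → ℝ} (hχ : Differentiable ℝ χ) (hw : Differentiable ℝ w)
    (c : ℝ) (y v : EuclideanSpace ℝ (Fin 2)) :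
    fderiv ℝ (fun z => χ z ^ 2 * (w z - c)) y v = 2 * χ y * fderiv ℝ χ y v * (w y - c) + χ y ^ 2 * fderiv ℝ w y v := by
  have h1 : HasFDerivAt χ (fderiv ℝ χ y) y := (hχ y).hasFDerivAt
  have h2 : HasFDerivAt (fun z => w z - c) (fderiv ℝ w y) y := (hw y).hasFDerivAt.sub_const c
  have h := (h1.mul h1).mul h2
  have e : (fun z => χ z ^ 2 * (w z - c)) = (χ * χ * fun z => w z - c) := by
    funext z; simp only [Pi.mul_apply, sq]
  rw [e, h.fderiv]
  simp only [add_apply, FunLike.coe_smul, Pi.smul_apply, smul_eq_mul, Pi.mul_apply]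
  ring

/-- ★★ **THE ROW TESTED WITH `χ²·(u − c)`.**  Let `u : E² → ℝ` be continuous with `|u| ≤ M`, with a weak gradient `Gu` on the
plane, `Gu(e_k) ∈ L²`; let `g₀, g₁ ∈ L²`, `J ∈ L¹` satisfy the row `−∫ Σ_k ∂_kη g_k = 2∫ η J` for all smooth compactly supported
`η`.  Then for every smooth compactly supported `χ` and every `c ∈ ℝ`:
`−∫ Σ_k (2χ ∂_kχ (u − c) + χ² Gu(e_k)) g_k = 2 ∫ χ² (u − c) J`.
(Proof: the row for `η_n = χ²(ρ_n ⋆ u − c)`; `∂_k(ρ_n ⋆ u) = ρ_n ⋆ ∂_k u → ∂_k u` in `L²` against `χ² g_k ∈ L²`; `ρ_n ⋆ u → u`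
pointwise and boundedly against `χ ∂_kχ g_k, χ² J ∈ L¹`.) [cite: Wente1969, §2 (energy identity by cut-off); Evans2010, §5.3.1 Thm. 1] -/
theorem localised_row (hu : HasWeakFDerivOn ⟨Set.univ, isOpen_univ⟩ volume u Gu) (huc : Continuous u)
    {M : ℝ} (huM : ∀ y, |u y| ≤ M)
    (hGu : ∀ k : Fin 2, MemLp (fun y => Gu y (EuclideanSpace.single k (1:ℝ))) 2 volume)
    {g : Fin 2 → EuclideanSpace ℝ (Fin 2) → ℝ} (hg : ∀ k, MemLp (g k) 2 volume)
    {J : EuclideanSpace ℝ (Fin 2) → ℝ} (hJ : Integrable J volume)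
    (hrow : ∀ (η : EuclideanSpace ℝ (Fin 2) → ℝ), ContDiff ℝ ∞ η → HasCompactSupport η →
      -(∫ y, ∑ k : Fin 2, fderiv ℝ η y (EuclideanSpace.single k (1:ℝ)) * g k y) = 2 * ∫ y, η y * J y)
    {χ : EuclideanSpace ℝ (Fin 2) → ℝ} (hχ : ContDiff ℝ ∞ χ) (hχc : HasCompactSupport χ) (c : ℝ) :
    -(∫ y, ∑ k : Fin 2, (2 * χ y * fderiv ℝ χ y (EuclideanSpace.single k (1:ℝ)) * (u y - c) +
        χ y ^ 2 * Gu y (EuclideanSpace.single k (1:ℝ))) * g k y) =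
      2 * ∫ y, χ y ^ 2 * (u y - c) * J y := by
  -- the mollifier sequence and the mollified `u`
  obtain ⟨φ, hφ, -⟩ := exists_contDiffBump_seq (E := EuclideanSpace ℝ (Fin 2))
  set w : ℕ → EuclideanSpace ℝ (Fin 2) → ℝ := fun n => (φ n).normed volume ⋆[lsmul ℝ ℝ, volume] u with hwdef
  have hwC : ∀ n, ContDiff ℝ ∞ (w n) := fun n => contDiff_mollify hu (φ n)
  have hwd : ∀ n, Differentiable ℝ (w n) := fun n => (hwC n).differentiable (by simp)
  have hwc : ∀ n, Continuous (w n) := fun n => (hwC n).continuous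
  have hwM : ∀ n y, |w n y| ≤ 3 * M := fun n y => abs_mollify_le huc huM (φ n) y
  have hwlim : ∀ y, Tendsto (fun n => w n y) atTop (𝓝 (u y)) := fun y => tendsto_mollify huc hφ y
  have hχd : Differentiable ℝ χ := hχ.differentiable (by simp)
  have hχ'c : ∀ v, Continuous fun y => fderiv ℝ χ y v := fun v => (hχ.continuous_fderiv (by simp)).clm_apply continuous_const
  have hχ's : ∀ v, HasCompactSupport fun y => fderiv ℝ χ y v := fun v => hχc.fderiv_apply (𝕜 := ℝ) v
  have hM0 : 0 ≤ M := (abs_nonneg _).trans (huM 0)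
  have hχ2c : HasCompactSupport (fun y => χ y ^ 2) := by
    rw [show (fun y => χ y ^ 2) = χ * χ from funext fun y => by simp only [Pi.mul_apply, sq]]
    exact hχc.mul_right
  -- the test functions `η_n = χ² (w_n − c)` and the row for them
  have hηC : ∀ n, ContDiff ℝ ∞ (fun y => χ y ^ 2 * (w n y - c)) := fun n => (hχ.pow 2).mul ((hwC n).sub contDiff_const)
  have hηc : ∀ n, HasCompactSupport (fun y => χ y ^ 2 * (w n y - c)) := fun n => hχ2c.mul_right
  have row : ∀ n, -(∫ y, ∑ k : Fin 2, fderiv ℝ (fun y => χ y ^ 2 * (w n y - c)) y (EuclideanSpace.single k (1:ℝ)) * g k y) =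
      2 * ∫ y, χ y ^ 2 * (w n y - c) * J y := by
    intro n
    exact hrow _ (hηC n) (hηc n)
  -- abbreviations for the four kinds of integrands
  set e : Fin 2 → EuclideanSpace ℝ (Fin 2) := fun k => EuclideanSpace.single k (1:ℝ) with hedef
  -- `L²` ∕ `L^∞` letters
  have hχtop : MemLp χ ∞ volume := by
    obtain ⟨C, hC⟩ := hχc.exists_bound_of_continuous hχ.continuous
    exact memLp_top_of_bound hχ.continuous.aestronglyMeasurable C (Eventually.of_forall hC)
  have hAc : ∀ k, Continuous fun y => 2 * χ y * fderiv ℝ χ y (e k) :=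
    fun k => (continuous_const.mul hχ.continuous).mul (hχ'c (e k))
  have hAs : ∀ k, HasCompactSupport fun y => 2 * χ y * fderiv ℝ χ y (e k) :=
    fun k => (hχ's (e k)).mul_left (f := fun y => 2 * χ y)
  have hA2 : ∀ k, MemLp (fun y => 2 * χ y * fderiv ℝ χ y (e k)) 2 volume :=
    fun k => (hAc k).memLp_of_hasCompactSupport (hAs k)
  have hχ2top : MemLp (fun y => χ y ^ 2) ∞ volume := by
    have := MemLp.mul' (r := ∞) hχtop hχtop
    refine this.congr_norm (hχ.continuous.pow 2).aestronglyMeasurable (Eventually.of_forall fun y => ?_)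
    simp [sq]
  -- (a) the cut-off terms: dominated convergence
  have limA : ∀ k, Tendsto (fun n => ∫ y, 2 * χ y * fderiv ℝ χ y (e k) * (w n y - c) * g k y) atTop
      (𝓝 (∫ y, 2 * χ y * fderiv ℝ χ y (e k) * (u y - c) * g k y)) := by
    intro k
    have hbi : Integrable (fun y => (3 * M + |c|) * |2 * χ y * fderiv ℝ χ y (e k) * g k y|) volume := by
      have h1 : Integrable (fun y => 2 * χ y * fderiv ℝ χ y (e k) * g k y) volume := integrable_mul_of_L2 (hA2 k) (hg k)
      exact (h1.abs).const_mul _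
    refine tendsto_integral_of_dominated_convergence _ (fun n => ?_) hbi (fun n => Eventually.of_forall fun y => ?_)
      (Eventually.of_forall fun y => ?_)
    · exact ((((continuous_const.mul hχ.continuous).mul (hχ'c (e k))).mul ((hwc n).sub continuous_const)).aestronglyMeasurable).mul
        (hg k).aestronglyMeasurable
    · rw [Real.norm_eq_abs, show 2 * χ y * fderiv ℝ χ y (e k) * (w n y - c) * g k y =
        (w n y - c) * (2 * χ y * fderiv ℝ χ y (e k) * g k y) by ring, abs_mul]
      refine mul_le_mul_of_nonneg_right ?_ (abs_nonneg _)
      exact (abs_sub _ _).trans (add_le_add (hwM n y) le_rfl)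
    · exact ((((hwlim y).sub_const c).const_mul _).mul_const _)
  -- (b) the gradient terms: `L² × L² → L¹`
  have limB : ∀ k, Tendsto (fun n => ∫ y, χ y ^ 2 * g k y * fderiv ℝ (w n) y (e k)) atTop
      (𝓝 (∫ y, χ y ^ 2 * g k y * Gu y (e k))) := by
    intro k
    have ha : MemLp (fun y => χ y ^ 2 * g k y) 2 volume := MemLp.mul' (r := 2) (hg k) hχ2top
    have hbs : ∀ n, AEStronglyMeasurable (fun y => fderiv ℝ (w n) y (e k)) volume :=
      fun n => (((hwC n).continuous_fderiv (by simp)).clm_apply continuous_const).aestronglyMeasurable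
    exact (tendsto_integral_mul_of_L2 ha (hGu k) hbs (tendsto_eLpNorm_grad_sub_mollify hu hφ (hGu k))).2
  -- (c) the right-hand side: dominated convergence
  have limC : Tendsto (fun n => 2 * ∫ y, χ y ^ 2 * (w n y - c) * J y) atTop (𝓝 (2 * ∫ y, χ y ^ 2 * (u y - c) * J y)) := by
    refine Tendsto.const_mul 2 ?_
    obtain ⟨C, hC⟩ := hχc.exists_bound_of_continuous hχ.continuous
    have hC0 : 0 ≤ C := (norm_nonneg _).trans (hC 0)
    have hbi : Integrable (fun y => C ^ 2 * (3 * M + |c|) * |J y|) volume := (hJ.abs).const_mul _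
    refine tendsto_integral_of_dominated_convergence _ (fun n => ?_) hbi (fun n => Eventually.of_forall fun y => ?_)
      (Eventually.of_forall fun y => ?_)
    · exact (((hχ.continuous.pow 2).mul ((hwc n).sub continuous_const)).aestronglyMeasurable).mul hJ.aestronglyMeasurable
    · rw [Real.norm_eq_abs, abs_mul, abs_mul]
      have h1 : |χ y ^ 2| ≤ C ^ 2 := by
        rw [abs_pow, ← Real.norm_eq_abs]; exact pow_le_pow_left₀ (norm_nonneg _) (hC y) 2
      have h2 : |w n y - c| ≤ 3 * M + |c| := (abs_sub _ _).trans (add_le_add (hwM n y) le_rfl)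
      calc |χ y ^ 2| * |w n y - c| * |J y| ≤ C ^ 2 * (3 * M + |c|) * |J y| := by
            gcongr
          _ = C ^ 2 * (3 * M + |c|) * |J y| := rfl
    · exact (((hwlim y).sub_const c).const_mul _).mul_const _
  -- integrability of the two kinds of terms at stage `n`
  have intA : ∀ n k, Integrable (fun y => 2 * χ y * fderiv ℝ χ y (e k) * (w n y - c) * g k y) volume := by
    intro n k
    have hc' : Continuous fun y => 2 * χ y * fderiv ℝ χ y (e k) * (w n y - c) :=
      ((continuous_const.mul hχ.continuous).mul (hχ'c (e k))).mul ((hwc n).sub continuous_const)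
    have hs' : HasCompactSupport fun y => 2 * χ y * fderiv ℝ χ y (e k) * (w n y - c) :=
      (hAs k).mul_right
    exact integrable_mul_of_L2 (hc'.memLp_of_hasCompactSupport hs') (hg k)
  have intB : ∀ n k, Integrable (fun y => χ y ^ 2 * g k y * fderiv ℝ (w n) y (e k)) volume := by
    intro n k
    have hc' : Continuous fun y => χ y ^ 2 * fderiv ℝ (w n) y (e k) :=
      (hχ.continuous.pow 2).mul (((hwC n).continuous_fderiv (by simp)).clm_apply continuous_const)
    have hs' : HasCompactSupport fun y => χ y ^ 2 * fderiv ℝ (w n) y (e k) := hχ2c.mul_right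
    have := integrable_mul_of_L2 (hc'.memLp_of_hasCompactSupport hs') (hg k)
    exact this.congr (Eventually.of_forall fun y => by simp only; ring)
  -- the left-hand side at stage `n`, split into the `2 × 2` integrals
  have lhs : ∀ n, ∫ y, ∑ k : Fin 2, fderiv ℝ (fun y => χ y ^ 2 * (w n y - c)) y (e k) * g k y =
      ∑ k : Fin 2, ((∫ y, 2 * χ y * fderiv ℝ χ y (e k) * (w n y - c) * g k y) +
        ∫ y, χ y ^ 2 * g k y * fderiv ℝ (w n) y (e k)) := by
    intro n
    have hF : ∀ k, (fun y => fderiv ℝ (fun y => χ y ^ 2 * (w n y - c)) y (e k) * g k y) =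
        fun y => 2 * χ y * fderiv ℝ χ y (e k) * (w n y - c) * g k y + χ y ^ 2 * g k y * fderiv ℝ (w n) y (e k) := by
      intro k; funext y
      rw [fderiv_sq_mul_sub_apply hχd (hwd n) c]
      ring
    rw [integral_finsetSum _ (fun k _ => by rw [hF k]; exact (intA n k).add (intB n k))]
    refine Finset.sum_congr rfl fun k _ => ?_
    rw [hF k, integral_add (intA n k) (intB n k)]
  -- pass to the limit in the row
  have hL : Tendsto (fun n => -(∑ k : Fin 2, ((∫ y, 2 * χ y * fderiv ℝ χ y (e k) * (w n y - c) * g k y) +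
      ∫ y, χ y ^ 2 * g k y * fderiv ℝ (w n) y (e k)))) atTop
      (𝓝 (-(∑ k : Fin 2, ((∫ y, 2 * χ y * fderiv ℝ χ y (e k) * (u y - c) * g k y) +
        ∫ y, χ y ^ 2 * g k y * Gu y (e k))))) :=
    (tendsto_finsetSum _ fun k _ => (limA k).add (limB k)).neg
  have hL' : Tendsto (fun n => -(∑ k : Fin 2, ((∫ y, 2 * χ y * fderiv ℝ χ y (e k) * (w n y - c) * g k y) +
      ∫ y, χ y ^ 2 * g k y * fderiv ℝ (w n) y (e k)))) atTop (𝓝 (2 * ∫ y, χ y ^ 2 * (u y - c) * J y)) := by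
    refine limC.congr fun n => ?_
    rw [← row n, lhs n]
  have key := tendsto_nhds_unique hL hL'
  -- identify the limit with the claimed left-hand side
  have intA' : ∀ k, Integrable (fun y => 2 * χ y * fderiv ℝ χ y (e k) * (u y - c) * g k y) volume := by
    intro k
    have hc' : Continuous fun y => 2 * χ y * fderiv ℝ χ y (e k) * (u y - c) :=
      ((continuous_const.mul hχ.continuous).mul (hχ'c (e k))).mul (huc.sub continuous_const)
    have hs' : HasCompactSupport fun y => 2 * χ y * fderiv ℝ χ y (e k) * (u y - c) :=
      (hAs k).mul_right
    exact integrable_mul_of_L2 (hc'.memLp_of_hasCompactSupport hs') (hg k)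
  have intB' : ∀ k, Integrable (fun y => χ y ^ 2 * g k y * Gu y (e k)) volume :=
    fun k => integrable_mul_of_L2 (MemLp.mul' (r := 2) (hg k) hχ2top) (hGu k)
  rw [← key, integral_finsetSum _ (fun k _ => ((intA' k).add (intB' k)).congr
    (Eventually.of_forall fun y => by simp only [Pi.add_apply]; ring))]
  congr 1
  refine Finset.sum_congr rfl fun k _ => ?_
  rw [← integral_add (intA' k) (intB' k)]
  refine integral_congr_ae (Eventually.of_forall fun y => ?_)
  ring

end Summit.QuantumFields.YangMills.Theorems.PoincareLipschitzHSystemEnergyIdentityLetters
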